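import Summits.Langlands.Langlands.Theorems.TatePhantomLiftPrelude

/-!
# TatePhantomLift — «a minimal counterexample to the extension crux EXT is a FINITE PHANTOM TWIST; enlarge the layer to kill it
# and re-enter rigidity one floor up» (decomp-langlands · lens 4 «minimal-counterexample / extremal reduction» · generation 26)

TARGET (node-local, restated VERBATIM from generation 25, sha12 `330085e4f017`; its child-route birth is frozen under the cell's ROUTE
FREEZE of 2026-08-31): **EXT** = `PerfectLayerClifford.PerfectLayerExtension`, the DECIDING crux (rank 2) of the g25 node
`RPERF ⟸ EXT ∧ RIGID ∧ FINTYPE ∧ RED°` under `GaloisHullLift.PerfectHullDescent` (stmt-Langlands-28225).  EXT says: along a finite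
Galois layer `L/K` WITHOUT cyclic sub-layers of prime degree, an IRREDUCIBLE semisimple `ℓ`-adic RELATIVE AVATAR `r : Γ_L → GL_n(ℚ̄_ℓ)`
of an L-algebraic cuspidal `π` of `GL_n/K` (Frobenius polynomials of `r` at almost all `w ∣ v` = the `f(w|v)`-th power Satake
polynomial of `π_v`) is the restriction of some semisimple `ρ₀ : Γ_K → GL_n(ℚ̄_ℓ)` carrying the same relative avatar.

THE EXTREMAL REDUCTION.  Suppose EXT fails for `(π, L/K, r)`.  (1) The hypothesis of EXT is `Gal(L/K)`-INVARIANT, so by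
Chebotarev + Brauer–Nesbitt over `L` (tree `FramedGaloisRep.nonempty_equiv_outerConj`, PROVED) `r^τ ≅ r` for every `τ ∈ Γ_K`
(`relAvatar_invariant`, 0 sorry).  (2) TATE'S THEOREM `H²(Γ_K, ℚ/ℤ) = 0` (Serre 1977, Thm 4; Patrikis arXiv:1207.6724 Thm 1.0.16 /
Prop 1.0.18 = Conrad's lifting Prop 5.3) + Clifford: an invariant irreducible `r` ALWAYS extends to `Γ_K` UP TO A TWIST ON `Γ_L` —
`ρ₁|Γ_L = r ⊗ c` for a continuous character `c` of `Γ_L` (piece **TP**, print, NOT S-implied, excess support).  So the minimal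
counterexample is a PHANTOM TWIST `c`.  (3) `det`: `cⁿ = (det ρ₁ · Ψ₀⁻¹)|Γ_L` where `Ψ₀` is an extension of `det r` to `Γ_K`
(piece **W1** = EXT for `GL₁`, S-implied, the `n = 1` Hecke-character avatar — closed modulo print).  (4) ℓ-adic characters of
`Γ_K` are divisible modulo torsion (piece **DIV**, elementary; rung `ℓ ≠ 2 ∧ ℓ ∤ n` PROVED here from the tree's `PadicCharacterNthRoot`):
re-twisting `ρ₁` by `ψ⁻¹` with `ψⁿ ≡ det ρ₁ · Ψ₀⁻¹ (mod torsion)` makes `c` of FINITE ORDER.  (5) A finite-order character of `Γ_L`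
dies on `Γ_{L'}` for a finite Galois `L'/K ⊇ L` with `Gal(L'/L)` abelian (piece **LAY**, elementary Galois theory).  Transport along the
tower (`exists_absGaloisRestrict_absGaloisRestrict_eq_conj`, PROVED) gives an IRREDUCIBLE `ρ₁'` over `K` with `ρ₁'|Γ_{L'}` CONJUGATE to
`r|Γ_{L'}` — a candidate one floor up.  (5½) If some twist of `ρ₁'` by a character of `Γ_K` restricts to a conjugate of `r` on `Γ_L` (a FAKE
phantom), that twist, re-framed, extends `r` on the nose and EXT holds with no further input (kernel, PROVED); so the extremal phantom is
GENUINE, and genuineness travels into the residual as a hypothesis.  (6) If the enlarged layer `L'/K` again has no cyclic-prime sub-layer and `r|Γ_{L'}`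
stays irreducible, the EXISTING sibling crux **RIGID** (g25 rank 3, restated verbatim) applied to `(π, L'/K, r|Γ_{L'}, ρ₁')` returns a
compatible `ρ` over `K`, whose restriction to `Γ_L` is the relative avatar EXT wants (g25 L1).  (7) Otherwise we are in the
IMPRIMITIVE cell — `L'/K` acquired a cyclic-prime sub-layer (solvable peel from the top: BCE 27863 / CPD 27860 / induction on `[L':K]`)
or `r|Γ_{L'}` became reducible (`r` is induced from an intermediate layer: the self-twisted branch RSELF 28226 / FINTYPE) — which is
the DECLARED RESIDUAL **ELCR**, strictly weaker than EXT.

NET EFFECT on the programme: the Schur-multiplier crux EXT is ELIMINATED in favour of RIGID (already an item of the g25 plan) plus a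
residual living in the solvable/induced regime the parent routes own:  RPERF ⟸ RIGID ∧ ELCR ∧ FINTYPE ∧ RED° ∧ W1 ∧ [TP, DIV, LAY]
(`closes_host`, 0 sorry).  This supersedes the critic's suggested coprime leaf `gcd(n,[L:K]) = 1` (a3 on row 317): the phantom-twist
normal form covers every `n`.

PIECES (6; every binder of `closes` is consumed):
* TP    `TateTwistedExtension`          support · PRINT [Tate; Conrad Prop 5.3; Patrikis 1207.6724 Prop 1.0.18; Clifford] · NOT S-implied · EXCESS
* W1    `LayerDeterminantDescent`       support · S-implied · EXT-implied (`w1_of_ext`) · GL₁ avatar of a Hecke character, closed mod print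
* DIV   `AdicRootModTorsion`            support · elementary ℓ-adic analysis · NOT S-implied · EXCESS · rung `div_rung` (ℓ ≠ 2, ℓ ∤ N) PROVED
* LAY   `FiniteCharacterSplitting`      support · elementary Galois theory · NOT S-implied · EXCESS
* RIGID `PerfectLayerRigidity`          crux · g25 rank 3 RESTATED VERBATIM (sha12 `6f5d782b2b84`) · S-implied · LATERAL (sibling of EXT)
* ELCR  `ImprimitiveEnlargementDescent` DECLARED RESIDUAL · S-implied · EXT-implied (`elcr_of_ext`) · GENUINE phantoms in the imprimitive cell only

KERNEL `ext_of_pieces` / `closes` (0 sorry) · exactness `w1_of_ext`, `elcr_of_ext`, `ext_iff_pieces : TP → DIV → LAY → RIGID → (EXT ↔ W1 ∧ ELCR)` · S-implied: `ext_of_langlands`, `rigid_of_langlands`,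
`w1_of_langlands`, `elcr_of_langlands` · flattened host corollary `closes_host : RIGID → FINTYPE → RED° → TP → W1 → DIV → LAY → ELCR →
GaloisHullLift.PerfectHullDescent` BY NAME and the chain `closes_parent` / `closes_grandparent` through the tree's inlined `closes` theorems.
-/

set_option linter.dupNamespace false
set_option linter.unusedVariables false
set_option linter.style.longLine false

namespace Summit.Langlands.Langlands.Theorems.TatePhantomLift

/-- Pointwise inverse of a continuous `ℓ`-adic character (specialisation, to `(PadicAlgCl ℓ)ˣ`-valued characters, of the tree's
`ContinuousMonoidHom.inv_apply'` of `Literature/NumberTheory/GaloisRepresentations/PstWeilDeligneCharacterTwists.lean`, whose module has no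
farm olean on 2026-08-31 and therefore cannot be imported here; `rfl`). [folklore] -/
theorem padicChar_inv_apply {G : Type*} [Monoid G] [TopologicalSpace G] {ℓ : ℕ} [Fact ℓ.Prime]
    (f : G →ₜ* (PadicAlgCl ℓ)ˣ) (x : G) : f⁻¹ x = (f x)⁻¹ := rfl

open scoped BigOperators Topology Manifold Classical MeasureTheory ProbabilityTheory Matrix InnerProductSpace ComplexConjugate ContinuousMap
open Filter Set Function TopologicalSpace MeasureTheory
open Literature.NumberTheory.GaloisRepresentations Literature.NumberTheory.Automorphic
open IsDedekindDomain
open Summit.Langlands.Langlands.Theses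
open Summit.Langlands.Langlands.Theses.GaloisHullLift
open scoped NumberField Polynomial

/-! ## §3 KERNEL: TP ∧ W1 ∧ DIV ∧ LAY ∧ RIGID ∧ ELCR ⟹ EXT (the phantom-twist normal form; 0 sorry) -/

/-- **KERNEL (pieces ⟹ target).** -/
theorem ext_of_pieces (hT : TateTwistedExtension) (hW : LayerDeterminantDescent) (hD : AdicRootModTorsion)
    (hY : FiniteCharacterSplitting) (hR : PerfectLayerRigidity) (hI : ImprimitiveEnlargementDescent) : PerfectLayerExtension := by
  intro K _ _ n hcpt hn π hπ L _ _ _ hGal h1 hnc ℓ _ ι r hr hirr hrel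
  haveI := hGal
  -- (1) invariance: `r^τ ≃ r` for all `τ ∈ Γ_K` (Chebotarev–Brauer–Nesbitt over `L`)
  have hinv : ∀ τ : Field.absoluteGaloisGroup K, ∃ P : GL (Fin n) (PadicAlgCl ℓ),
      FramedRep.conj P (FramedGaloisRep.outerConj τ r) = r := relAvatar_invariant π.1 ι r hr hrel
  -- (2) Tate–Clifford: `ρ₁|Γ_L = r ⊗ c`
  obtain ⟨ρ₁, c, hρ₁⟩ := hT K L ℓ n r hirr hinv
  -- (3) the determinant of `r` descends
  obtain ⟨Ψ₀, hΨ₀⟩ := hW K n hcpt hn π hπ L hGal h1 hnc ℓ ι r hr hirr hrel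
  -- `cⁿ = Φ|Γ_L` with `Φ := det ρ₁ · Ψ₀⁻¹`
  set Φ : Field.absoluteGaloisGroup K →ₜ* (PadicAlgCl ℓ)ˣ := FramedRep.det ρ₁ * Ψ₀⁻¹ with hΦ
  have hcn : ∀ σ : Field.absoluteGaloisGroup L, c σ ^ n = Φ (absGaloisRestrict K L σ) := by
    intro σ
    have hdet : Matrix.GeneralLinearGroup.det (ρ₁ (absGaloisRestrict K L σ)) = c σ ^ n * Matrix.GeneralLinearGroup.det (r σ) := by
      change Matrix.GeneralLinearGroup.det ((ρ₁.restrictField L) σ) = _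
      rw [hρ₁, FramedRep.det_twist_apply]
    rw [hΦ, ContinuousMonoidHom.mul_apply, padicChar_inv_apply, FramedRep.det_apply, hdet, hΨ₀ σ, mul_inv_cancel_right]
  -- (4) divide: `ψⁿ ≡ Φ` modulo torsion; `c' := c · (ψ|Γ_L)⁻¹` has finite order `n·m`
  obtain ⟨ψ, m, hm, hψ⟩ := hD K ℓ Φ n hn
  set c' : Field.absoluteGaloisGroup L →ₜ* (PadicAlgCl ℓ)ˣ := c * (ψ.comp (absGaloisRestrict K L))⁻¹ with hc'
  have hfin : ∀ σ : Field.absoluteGaloisGroup L, c' σ ^ (n * m) = 1 := by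
    intro σ
    have h := hψ (absGaloisRestrict K L σ)
    rw [← hcn σ] at h
    -- invert: `(c σ ^ n * (ψ (res σ) ^ n)⁻¹) ^ m = 1`
    have h' := congrArg Inv.inv h
    rw [inv_one, ← inv_pow, mul_inv_rev, inv_inv] at h'
    have e1 : c' σ ^ (n * m) = (c σ ^ n * (ψ (absGaloisRestrict K L σ) ^ n)⁻¹) ^ m := by
      rw [pow_mul, ← inv_pow, ← mul_pow, hc']
      rfl
    rw [e1]
    exact h'
  -- (5) kill `c'` on a finite Galois `L'/K ⊇ L` with `Gal(L'/L)` abelian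
  obtain ⟨L', iF, iN, iA, iA', iT, hGal', hab, hc'1⟩ := hY K L hGal ℓ c' ⟨n * m, Nat.mul_pos hn hm, hfin⟩
  -- the re-twisted extension `ρ₁' := ρ₁ ⊗ ψ⁻¹` restricts to `r ⊗ c'` on `Γ_L` …
  set ρ₁' : FramedGaloisRep K (PadicAlgCl ℓ) n := FramedRep.twist ρ₁ ψ⁻¹ with hρ₁'
  have h8 : ρ₁'.restrictField L = FramedRep.twist r c' := by
    rw [hρ₁', restrictField_twist, hρ₁, FramedRep.twist_twist, hc']
    congr 1
    exact ContinuousMonoidHom.ext fun σ => by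
      rw [ContinuousMonoidHom.mul_apply, ContinuousMonoidHom.mul_apply, cmh_comp_apply, padicChar_inv_apply, padicChar_inv_apply, cmh_comp_apply]
      exact mul_comm _ _
  -- … hence is irreducible (and semisimple) …
  have hirr₁ : ρ₁'.IsIrreducible := isIrreducible_of_restrictField ρ₁' (h8 ▸ isIrreducible_twist r c' hirr)
  have hss₁ : ρ₁'.toGaloisRep.IsSemisimple := by
    haveI : ρ₁'.toGaloisRep.toRepresentation.IsIrreducible := hirr₁
    change ComplementedLattice _
    infer_instance
  -- … and to a CONJUGATE of `r|Γ_{L'}` on `Γ_{L'}` (`c'` dies there; the tower costs an inner automorphism)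
  obtain ⟨τ, hτ⟩ := exists_restrictField_restrictField_eq_conj (K := K) (L := L) (ℓ := ℓ) (n := n) L'
  have hcomp1 : c'.comp (absGaloisRestrict L L') = 1 := ContinuousMonoidHom.ext fun σ => hc'1 σ
  have key : ρ₁'.restrictField L' = FramedRep.conj (ρ₁' τ) (r.restrictField L') := by
    have h := hτ ρ₁'
    rw [h8, restrictField_twist, hcomp1, FramedRep.twist_one] at h
    -- h : r.restrictField L' = conj (ρ₁' τ)⁻¹ (ρ₁'.restrictField L')
    rw [h, conj_conj, mul_inv_cancel, conj_one]
  -- (5½) is the phantom GENUINE?  If some `Γ_K`-twist of `ρ₁'` restricts to a conjugate of `r` on `Γ_L`, that twist (re-framed) extends `r`: done.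
  by_cases hgen : ∃ (χ : Field.absoluteGaloisGroup K →ₜ* (PadicAlgCl ℓ)ˣ) (P : GL (Fin n) (PadicAlgCl ℓ)),
      FramedGaloisRep.restrictField L (FramedRep.twist ρ₁' χ) = FramedRep.conj P r
  · obtain ⟨χ, P, hχ⟩ := hgen
    set ρ₀ : FramedGaloisRep K (PadicAlgCl ℓ) n := FramedRep.conj P⁻¹ (FramedRep.twist ρ₁' χ) with hρ₀
    have h0 : ρ₀.restrictField L = r := by
      rw [hρ₀, restrictField_conj, hχ, conj_conj, inv_mul_cancel, conj_one]
    have hirr₀ : ρ₀.IsIrreducible := isIrreducible_of_restrictField ρ₀ (h0 ▸ hirr : (ρ₀.restrictField L).IsIrreducible)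
    have hss₀ : ρ₀.toGaloisRep.IsSemisimple := by
      haveI : ρ₀.toGaloisRep.toRepresentation.IsIrreducible := hirr₀
      change ComplementedLattice _
      infer_instance
    refine ⟨ρ₀, hss₀, ?_⟩
    rw [h0]
    exact hrel
  have hgen' : ∀ (χ : Field.absoluteGaloisGroup K →ₜ* (PadicAlgCl ℓ)ˣ) (P : GL (Fin n) (PadicAlgCl ℓ)),
      FramedGaloisRep.restrictField L (FramedRep.twist ρ₁' χ) ≠ FramedRep.conj P r := fun χ P h => hgen ⟨χ, P, h⟩
  -- (6)/(7) case split on the enlarged layer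
  by_cases hstem : (¬ ∃ F : IntermediateField K L', F ≠ ⊥ ∧ IsGalois K ↥F ∧ IsCyclic (↥F ≃ₐ[K] ↥F) ∧ (Module.finrank K ↥F).Prime) ∧
      (r.restrictField L').IsIrreducible
  · -- STEM: RIGID one floor up, with candidate `ρ₁'`
    haveI := hGal'
    haveI : IsGalois L L' := IsGalois.tower_top_of_isGalois K L L'
    have h1' : Module.finrank K L' ≠ 1 := by
      intro h
      haveI : FiniteDimensional K L := Module.Finite.of_restrictScalars_finite ℚ K L
      haveI : FiniteDimensional L L' := Module.Finite.of_restrictScalars_finite ℚ L L'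
      have hmul := Module.finrank_mul_finrank K L L'
      rw [h] at hmul
      exact h1 (Nat.eq_one_of_mul_eq_one_right hmul)
    have hr' : (r.restrictField L').toGaloisRep.IsSemisimple := r.isSemisimple_restrictField hr
    have hrel' := relAvatar_tower π.1 ι r hrel L'
    have hcand := relAvatar_conj π.1 ι (r.restrictField L') (ρ₁' τ) hrel'
    rw [← key] at hcand
    obtain ⟨ρ, hρ, hc⟩ := hR K n hcpt hn π hπ L' hGal' h1' hstem.1 ℓ ι (r.restrictField L') hr' hstem.2 ⟨ρ₁', hss₁, hcand⟩ hrel'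
    exact ⟨ρ, hρ, relAvatar_restrictField_of_compatible π.1 ι ρ hc⟩
  · -- IMPRIMITIVE CELL: the declared residual
    have hcase : (∃ F : IntermediateField K L', F ≠ ⊥ ∧ IsGalois K ↥F ∧ IsCyclic (↥F ≃ₐ[K] ↥F) ∧ (Module.finrank K ↥F).Prime) ∨
        ¬ (r.restrictField L').IsIrreducible := by
      rcases not_and_or.mp hstem with h | h
      · exact Or.inl (not_not.mp h)
      · exact Or.inr h
    exact hI K n hcpt hn π hπ L hGal h1 hnc ℓ ι r hr hirr hrel L' hGal' hab ρ₁' hirr₁ ⟨ρ₁' τ, key⟩ hgen' hcase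

/-! ## §4 Exactness (pieces below the target or below S), the S-implications, and the iff with the literal «no phantom twist» -/

/-- **W1 ⟸ EXT** (the determinant of an extension extends the determinant; `r ≅ ρ₀|Γ_L` by Chebotarev–Brauer–Nesbitt over `L`). -/
theorem w1_of_ext (hE : PerfectLayerExtension) : LayerDeterminantDescent := by
  intro K _ _ n hcpt hn π hπ L _ _ _ hGal h1 hnc ℓ _ ι r hr hirr hrel
  haveI := hGal
  obtain ⟨ρ₀, hρ₀, h₀⟩ := hE K n hcpt hn π hπ L hGal h1 hnc ℓ ι r hr hirr hrel
  obtain ⟨e⟩ := FramedGaloisRep.nonempty_equiv_of_hasFrobCharpolyAt_eventually chebotarev_artinRep_holds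
    (ρ₀.restrictField L) r (ρ₀.isSemisimple_restrictField hρ₀) hr (frobenius_agree_of_relAvatar π.1 ι _ _ h₀ hrel)
  obtain ⟨P, hP⟩ := FramedRep.exists_eq_conj_of_equiv _ _ e
  refine ⟨FramedRep.det ρ₀, fun σ => ?_⟩
  rw [hP, FramedRep.conj_apply, det_conj_apply, FramedRep.det_apply, FramedGaloisRep.restrictField_apply]

/-- **ELCR ⟸ EXT** (drop the enlargement data). -/
theorem elcr_of_ext (hE : PerfectLayerExtension) : ImprimitiveEnlargementDescent := by
  intro K _ _ n hcpt hn π hπ L _ _ _ hGal h1 hnc ℓ _ ι r hr hirr hrel L' _ _ _ _ _ hGal' hab ρ₁ hρ₁ hP hgen hcell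
  exact hE K n hcpt hn π hπ L hGal h1 hnc ℓ ι r hr hirr hrel

/-- **EXACTNESS modulo the excess facts and the lateral sibling**: given TP, DIV, LAY (print / elementary) and RIGID (g25 r3), the target EXT is
EQUIVALENT to W1 ∧ ELCR — the split loses nothing beyond what it declares. -/
theorem ext_iff_pieces (hT : TateTwistedExtension) (hD : AdicRootModTorsion) (hY : FiniteCharacterSplitting) (hR : PerfectLayerRigidity) :
    PerfectLayerExtension ↔ (LayerDeterminantDescent ∧ ImprimitiveEnlargementDescent) :=
  ⟨fun h => ⟨w1_of_ext h, elcr_of_ext h⟩, fun h => ext_of_pieces hT h.1 hD hY hR h.2⟩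

/-- `Langlands ⟹ RPERF` (g25, local copy: the summit's `ρ_{π,ι}` is irreducible, hence semisimple, and compatible a.e.). -/
theorem perfect_of_langlands (hL : _root_.Langlands) : GaloisHullLift.PerfectHullDescent := by
  intro K _ _ n hcpt hn π hπ L _ _ _ hGal h1 hnc ℓ _ ι r hr hrel
  obtain ⟨⟨Rec⟩, h⟩ := hL K
  obtain ⟨ρ, hirr, -, hcorr, -⟩ := (h Rec n hn hcpt).1 π hπ ℓ ι
  have hss : ρ.toGaloisRep.IsSemisimple := by
    haveI : ρ.toGaloisRep.toRepresentation.IsIrreducible := hirr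
    change ComplementedLattice _
    infer_instance
  exact ⟨ρ, hss, hcorr.1⟩

/-- EXT is WEAKER than RPERF (g25 `ext_of_perfect`, local copy). -/
theorem ext_of_perfect (hP : GaloisHullLift.PerfectHullDescent) : PerfectLayerExtension := by
  intro K _ _ n hcpt hn π hπ L _ _ _ hGal h1 hnc ℓ _ ι r hr hirr hrel
  obtain ⟨ρ, hρ, hc⟩ := hP K n hcpt hn π hπ L hGal h1 hnc ℓ ι r hr hrel
  exact ⟨ρ, hρ, relAvatar_restrictField_of_compatible π.1 ι ρ hc⟩

/-- RIGID is WEAKER than RPERF (g25 `rigid_of_perfect`, local copy). -/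
theorem rigid_of_perfect (hP : GaloisHullLift.PerfectHullDescent) : PerfectLayerRigidity := by
  intro K _ _ n hcpt hn π hπ L _ _ _ hGal h1 hnc ℓ _ ι r hr hirr hext hrel
  exact hP K n hcpt hn π hπ L hGal h1 hnc ℓ ι r hr hrel

/-- EXT is S-implied (via RPERF). -/
theorem ext_of_langlands (hL : _root_.Langlands) : PerfectLayerExtension := ext_of_perfect (perfect_of_langlands hL)
/-- RIGID is S-implied (via RPERF). -/
theorem rigid_of_langlands (hL : _root_.Langlands) : PerfectLayerRigidity := rigid_of_perfect (perfect_of_langlands hL)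
/-- W1 is S-implied (via EXT). -/
theorem w1_of_langlands (hL : _root_.Langlands) : LayerDeterminantDescent := w1_of_ext (ext_of_langlands hL)
/-- ELCR (the declared residual) is S-implied (via EXT). -/
theorem elcr_of_langlands (hL : _root_.Langlands) : ImprimitiveEnlargementDescent := elcr_of_ext (ext_of_langlands hL)

/-- **DIV holds in the tame range** `ℓ ≠ 2 ∧ ℓ ∤ N` (rung, PROVED): the piece is open only at `ℓ = 2` or `ℓ ∣ N`. -/
theorem div_of_tame : ∀ (K : Type) [Field K] [NumberField K] (ℓ : ℕ) [Fact ℓ.Prime] (Ψ : Field.absoluteGaloisGroup K →ₜ* (PadicAlgCl ℓ)ˣ)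
    (N : ℕ), ℓ ≠ 2 → ¬ ℓ ∣ N → ∃ (ψ : Field.absoluteGaloisGroup K →ₜ* (PadicAlgCl ℓ)ˣ) (m : ℕ), 0 < m ∧
      ∀ g : Field.absoluteGaloisGroup K, (ψ g ^ N * (Ψ g)⁻¹) ^ m = 1 :=
  fun K _ _ ℓ _ Ψ N hℓ hN => div_rung hℓ Ψ hN

/-! ## §5 `closes` (the target BY NAME of this node), the flattened host corollary BY NAME, and the chain to `RootDecomp1.AvatarDescent` -/

/-- **tatePhantomLift_closes** (= the node's `closes`, renamed for the Theorems namespace) — the six pieces give the TARGET `PerfectLayerExtension` (node-local restatement of g25's deciding crux). -/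
theorem tatePhantomLift_closes (hT : TateTwistedExtension) (hW : LayerDeterminantDescent) (hD : AdicRootModTorsion) (hY : FiniteCharacterSplitting)
    (hR : PerfectLayerRigidity) (hI : ImprimitiveEnlargementDescent) : PerfectLayerExtension :=
  ext_of_pieces hT hW hD hY hR hI

/-- **Flattened host corollary** (g25 ∘ g26): `GaloisHullLift.PerfectHullDescent` (stmt-Langlands-28225) BY NAME from RIGID, FINTYPE, RED°
and this node's pieces — EXT no longer appears. -/
theorem closes_host (hR : PerfectLayerRigidity) (hF : FiniteTypePerfectDescent) (hRed : ReduciblePerfectDescent)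
    (hT : TateTwistedExtension) (hW : LayerDeterminantDescent) (hD : AdicRootModTorsion) (hY : FiniteCharacterSplitting)
    (hI : ImprimitiveEnlargementDescent) : GaloisHullLift.PerfectHullDescent := by
  have hE : PerfectLayerExtension := ext_of_pieces hT hW hD hY hR hI
  intro K _ _ n hcpt hn π hπ L _ _ _ hGal h1 hnc ℓ _ ι r hr hrel
  by_cases hirr : r.IsIrreducible
  · exact hR K n hcpt hn π hπ L hGal h1 hnc ℓ ι r hr hirr (hE K n hcpt hn π hπ L hGal h1 hnc ℓ ι r hr hirr hrel) hrel
  · by_cases hfin : (∀ᶠ v : IsDedekindDomain.HeightOneSpectrum (NumberField.RingOfIntegers K) in cofinite, ∀ α : Multiset ℂ, π.1.HasSatakeParamAt v α → ∀ a ∈ α, ∀ b ∈ α, ∃ k : ℕ, 0 < k ∧ a ^ k = b ^ k)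
    · exact hF K n hcpt hn π hπ L hGal h1 hnc ℓ ι r hr hirr hfin hrel
    · exact hRed K n hcpt hn π hπ L hGal h1 hnc ℓ ι r hr hirr hfin hrel

/-- Up one more level: `CyclicLayerPeeling.AnabelianLayerDescent` (tree `GaloisHullLift.closes`). -/
theorem closes_parent (hR : PerfectLayerRigidity) (hF : FiniteTypePerfectDescent) (hRed : ReduciblePerfectDescent)
    (hT : TateTwistedExtension) (hW : LayerDeterminantDescent) (hD : AdicRootModTorsion) (hY : FiniteCharacterSplitting)
    (hI : ImprimitiveEnlargementDescent) (hS : GaloisHullLift.SelfTwistedHullDescent) (hTr : GaloisHullLift.TrivialHullDescent)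
    (hC : CyclicLayerPeeling.PrimeCyclicLayerDescent) (hB : CyclicLayerPeeling.CyclicBaseChangeBelow) :
    CyclicLayerPeeling.AnabelianLayerDescent :=
  GaloisHullLift.closes (closes_host hR hF hRed hT hW hD hY hI) hS hTr hC hB

/-- Up to the root item: `RootDecomp1.AvatarDescent` (tree `CyclicLayerPeeling.closes`). -/
theorem closes_grandparent (hR : PerfectLayerRigidity) (hF : FiniteTypePerfectDescent) (hRed : ReduciblePerfectDescent)
    (hT : TateTwistedExtension) (hW : LayerDeterminantDescent) (hD : AdicRootModTorsion) (hY : FiniteCharacterSplitting)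
    (hI : ImprimitiveEnlargementDescent) (hS : GaloisHullLift.SelfTwistedHullDescent) (hTr : GaloisHullLift.TrivialHullDescent)
    (hC : CyclicLayerPeeling.PrimeCyclicLayerDescent) (hB : CyclicLayerPeeling.CyclicBaseChangeBelow)
    (hS' : CyclicLayerPeeling.SelfTwistedLayerDescent) : RootDecomp1.AvatarDescent :=
  CyclicLayerPeeling.closes hC (closes_parent hR hF hRed hT hW hD hY hI hS hTr hC hB) hS' hB

end Summit.Langlands.Langlands.Theorems.TatePhantomLift
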